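import Mathlib
import HarnessLib
import Summits.MatrixMultiplication.MatrixMultiplication.Theorems.OutsiderSandwichPencilSpanLaw

/-!
# OutsiderSandwich — the slice gap of `D^{⊠(N+1)}` below `1.5 ×` minrank
(decomp-mm lens 4 «minimal-counterexample / extremal reduction», gen 39, kernel K39-a; THESES-FREE,
DEFINITION-FREE — conventions of the pencil-calculus Parts I/II/IIc, the only summit-side imports)

Throughout `D` is ANY tensor with `hD : ∀ a b c, D a b c = if a ≠ b ∧ b ≠ c ∧ a ≠ c then 1 else 0`
(the diagonalised Coppersmith–Winograd tensor: `cw₂ ≅ D` over `ℂ`), `D(z) = contract3 D z` its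
`3 × 3` slices and `T_N(θ) = contract3 (D^{⊠N}) θ` the slices of its Kronecker powers.

* `§1` the `3 × 3` slices: full symmetry (`dslice_mulVec_comm`, `dslice_transpose`),
  `det D(z) = 2 z₀ z₁ z₂` (`det_dslice`), minrank `2` (`two_le_rank_dslice`), so `ker D(z)` is at most a
  line and **rigidity** (`exists_smul_of_common_kernel`): two covectors whose slices kill a common
  non-zero vector are proportional.
* `§2` product covectors `λ ⊗ μ` on words of length `2`: `T₂(λ ⊗ μ) = D(λ) ⊗ D(μ)`
  (`slice_prod_apply`) and the induced left/right annihilation of `col T₂(λ ⊗ μ)` by kernel vectors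
  of the factors (`left_vanish`, `right_vanish`).
* `§3` **the slice gap** (`exists_prod_of_rank_lt`): a non-zero covector on words of length `N + 1`
  whose slice has rank `< 3 · 2^N` splits off its first letter, `θ = λ ⊗ ζ` with a vanishing
  coordinate of `λ` and `2 · rank T_N(ζ) ≤ rank T_{N+1}(θ)` (via the span law of Part IIc).  For
  `N = 1` (`exists_prod_two`): every slice of `D^{⊠2}` of rank `≤ 5` is a product `λ ⊗ μ` with BOTH
  factors singular — the slice-rank spectrum `{4, 6, 7, 8, 9}` of `D^{⊠2} ≅ cw₂^{⊠2}` omits `5`.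
  This is the input of the subrank computation `Q(cw₂^{⊠2}) = 6` (Part K39-c).

References: [cite: CoppersmithWinograd1990, §6]; [cite: BlaserIkenmeyerLysikovPandeySchreyer2019, §5];
[cite: HornJohnson2013, §0.4].
-/

set_option linter.dupNamespace false

noncomputable section

namespace Summit.MatrixMultiplication.MatrixMultiplication.Theorems.OutsiderSandwichSliceGap

open Literature.Computability.AlgebraicComplexity
open Summit.MatrixMultiplication.MatrixMultiplication.Theorems.OutsiderSandwichPencilBlocks
open Summit.MatrixMultiplication.MatrixMultiplication.Theorems.OutsiderSandwichPencilSpan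
open Summit.MatrixMultiplication.MatrixMultiplication.Theorems.OutsiderSandwichPencilSpanLaw
open scoped Matrix BigOperators

/-! ## §0  Linear-algebra helpers -/

/-- A dependent pair with non-zero first member is proportional. [folklore] -/
theorem exists_smul_of_not_pair {V : Type*} [AddCommGroup V] [Module ℂ V] {x y : V}
    (hx : x ≠ 0) (h : ¬ LinearIndependent ℂ ![x, y]) : ∃ c : ℂ, y = c • x := by
  rw [LinearIndependent.pair_iff' hx] at h
  push Not at h
  obtain ⟨c, hc⟩ := h
  exact ⟨c, hc.symm⟩

/-- Two members of a subspace of dimension `≤ 1`, the first non-zero, are proportional. [folklore] -/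
theorem exists_smul_of_finrank_le_one {V : Type*} [AddCommGroup V] [Module ℂ V]
    [FiniteDimensional ℂ V] {W : Submodule ℂ V} (hW : Module.finrank ℂ W ≤ 1) {x y : V}
    (hx : x ∈ W) (hy : y ∈ W) (hx0 : x ≠ 0) : ∃ c : ℂ, y = c • x := by
  refine exists_smul_of_not_pair hx0 fun hind => ?_
  have hle : Submodule.span ℂ (Set.range ![x, y]) ≤ W := by
    rw [Submodule.span_le]
    rintro _ ⟨k, rfl⟩
    fin_cases k <;> simp [hx, hy]
  have h2 := Submodule.finrank_mono hle
  rw [finrank_span_eq_card hind] at h2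
  simp only [Fintype.card_fin] at h2
  omega

/-- Linearly independent vectors inside the range of a linear map from `W` number at most
`dim W`. [folklore] -/
theorem card_le_finrank_of_mem_range {V W : Type*} [AddCommGroup V] [Module ℂ V]
    [AddCommGroup W] [Module ℂ W] [FiniteDimensional ℂ V] [FiniteDimensional ℂ W]
    {ι : Type*} [Fintype ι] {α : ι → V} (hα : LinearIndependent ℂ α) (Ψ : W →ₗ[ℂ] V)
    (h : ∀ i, α i ∈ LinearMap.range Ψ) : Fintype.card ι ≤ Module.finrank ℂ W := by
  have hle : Submodule.span ℂ (Set.range α) ≤ LinearMap.range Ψ := by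
    rw [Submodule.span_le]
    rintro _ ⟨i, rfl⟩
    exact h i
  calc Fintype.card ι = Module.finrank ℂ (Submodule.span ℂ (Set.range α)) :=
        (finrank_span_eq_card hα).symm
    _ ≤ Module.finrank ℂ (LinearMap.range Ψ) := Submodule.finrank_mono hle
    _ ≤ Module.finrank ℂ W := LinearMap.finrank_range_le Ψ

/-- A `3 × 3` matrix of rank `≤ 2` has a kernel vector. [folklore] -/
theorem exists_mulVec_eq_zero_of_rank_le_two {M : Matrix (Fin 3) (Fin 3) ℂ} (h : M.rank ≤ 2) :
    ∃ x : Fin 3 → ℂ, x ≠ 0 ∧ M *ᵥ x = 0 := by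
  apply Matrix.exists_mulVec_eq_zero_iff.mpr
  by_contra hdet
  have hU : IsUnit M := (Matrix.isUnit_iff_isUnit_det M).mpr (isUnit_iff_ne_zero.mpr hdet)
  have := Matrix.rank_of_isUnit M hU
  simp only [Fintype.card_fin] at this
  omega

/-- Summation over words of length two, letter by letter. [folklore] -/
theorem sum_word_two {M : Type*} [AddCommMonoid M] (F : (Fin 2 → Fin 3) → M) :
    ∑ f, F f = ∑ b, ∑ c, F ![b, c] := by
  let e : (Fin 2 → Fin 3) ≃ Fin 3 × Fin 3 :=
    ⟨fun f => (f 0, f 1), fun p => ![p.1, p.2],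
      fun f => by funext j; fin_cases j <;> rfl, fun p => Prod.ext rfl rfl⟩
  rw [Fintype.sum_equiv e F (fun p => F ![p.1, p.2]) fun f => ?_, Fintype.sum_prod_type]
  change F f = F ![f 0, f 1]
  congr 1
  funext j; fin_cases j <;> rfl

/-! ## §1  The `3 × 3` slices `D(z) = contract3 D z` -/

variable {D : Fin 3 → Fin 3 → Fin 3 → ℂ}

/-- `D(z) u = D(u) z` (full symmetry of `D`). [cite: CoppersmithWinograd1990, §6] -/
theorem dslice_mulVec_comm (hD : ∀ a b c, D a b c = if a ≠ b ∧ b ≠ c ∧ a ≠ c then 1 else 0)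
    (z u : Fin 3 → ℂ) : contract3 D z *ᵥ u = contract3 D u *ᵥ z := by
  funext b
  fin_cases b <;> simp [Matrix.mulVec, dotProduct, contract3_apply, Fin.sum_univ_three, hD] <;> ring

/-- `D(z)` is symmetric. [cite: CoppersmithWinograd1990, §6] -/
theorem dslice_transpose (hD : ∀ a b c, D a b c = if a ≠ b ∧ b ≠ c ∧ a ≠ c then 1 else 0)
    (z : Fin 3 → ℂ) : (contract3 D z)ᵀ = contract3 D z := by
  ext b c
  fin_cases b <;> fin_cases c <;> simp [Matrix.transpose_apply, contract3_apply, Fin.sum_univ_three, hD]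

/-- `det D(z) = 2 z₀ z₁ z₂`. [cite: CoppersmithWinograd1990, §6] -/
theorem det_dslice (hD : ∀ a b c, D a b c = if a ≠ b ∧ b ≠ c ∧ a ≠ c then 1 else 0)
    (z : Fin 3 → ℂ) : (contract3 D z).det = 2 * z 0 * z 1 * z 2 := by
  rw [Matrix.det_fin_three]
  simp [contract3_apply, Fin.sum_univ_three, hD]
  ring

/-- A covector with a vanishing coordinate has a singular slice: `∃ x ≠ 0, D(z) x = 0`.
[cite: CoppersmithWinograd1990, §6] -/
theorem exists_mulVec_eq_zero_of_coord (hD : ∀ a b c, D a b c = if a ≠ b ∧ b ≠ c ∧ a ≠ c then 1 else 0)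
    {z : Fin 3 → ℂ} (a : Fin 3) (hz : z a = 0) : ∃ x : Fin 3 → ℂ, x ≠ 0 ∧ contract3 D z *ᵥ x = 0 := by
  apply Matrix.exists_mulVec_eq_zero_iff.mpr
  rw [det_dslice hD]
  fin_cases a <;> simp_all

/-- The slice of `D^{⊠1}` at `ζ` is the slice of `D` at `c ↦ ζ (fun _ ↦ c)`, up to reindexing; in
particular the ranks agree. [folklore] -/
theorem rank_slice_one (ζ : (Fin 1 → Fin 3) → ℂ) :
    (contract3 (kroneckerPow D 1) ζ).rank = (contract3 D fun c => ζ fun _ => c).rank := by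
  have hM : contract3 (kroneckerPow D 1) ζ =
      (contract3 D fun c => ζ fun _ => c).submatrix (Equiv.funUnique (Fin 1) (Fin 3))
        (Equiv.funUnique (Fin 1) (Fin 3)) := by
    ext w w'
    rw [Matrix.submatrix_apply, slice_apply, contract3_apply]
    simp only [Fin.prod_univ_one]
    refine Fintype.sum_equiv (Equiv.funUnique (Fin 1) (Fin 3)) _ _ fun f => ?_
    have hf : (fun _ : Fin 1 => f 0) = f := funext fun i => by rw [Subsingleton.elim i 0]
    change ζ f * D (f 0) (w 0) (w' 0) = ζ (fun _ => f 0) * D (f 0) (w 0) (w' 0)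
    rw [hf]
  rw [hM, Matrix.rank_submatrix]

/-- **Minrank of `D`**: `rank D(z) ≥ 2` for `z ≠ 0`. [cite: CoppersmithWinograd1990, §6] -/
theorem two_le_rank_dslice (hD : ∀ a b c, D a b c = if a ≠ b ∧ b ≠ c ∧ a ≠ c then 1 else 0)
    {z : Fin 3 → ℂ} (hz : z ≠ 0) : 2 ≤ (contract3 D z).rank := by
  have hζ : (fun w : Fin 1 → Fin 3 => z (w 0)) ≠ 0 :=
    fun h => hz (funext fun c => congr_fun h fun _ => c)
  have h := two_pow_le_rank_slice hD 1 hζ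
  rw [rank_slice_one] at h
  simpa using h

/-- `ker D(z)` is at most a line for `z ≠ 0`. [cite: CoppersmithWinograd1990, §6] -/
theorem finrank_ker_dslice_le_one (hD : ∀ a b c, D a b c = if a ≠ b ∧ b ≠ c ∧ a ≠ c then 1 else 0)
    {z : Fin 3 → ℂ} (hz : z ≠ 0) :
    Module.finrank ℂ (LinearMap.ker (contract3 D z).mulVecLin) ≤ 1 := by
  have h := LinearMap.finrank_range_add_finrank_ker (contract3 D z).mulVecLin
  have h2 := two_le_rank_dslice hD hz
  rw [Module.finrank_fintype_fun_eq_card, Fintype.card_fin] at h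
  change (contract3 D z).rank + _ = 3 at h
  omega

/-- **Rigidity**: if the slices `D(u)`, `D(v)` kill a common non-zero vector `z` and `u ≠ 0`, then
`v` is a multiple of `u`. [cite: CoppersmithWinograd1990, §6] -/
theorem exists_smul_of_common_kernel
    (hD : ∀ a b c, D a b c = if a ≠ b ∧ b ≠ c ∧ a ≠ c then 1 else 0) {z u v : Fin 3 → ℂ}
    (hz : z ≠ 0) (hu0 : u ≠ 0) (hu : contract3 D u *ᵥ z = 0) (hv : contract3 D v *ᵥ z = 0) :
    ∃ c : ℂ, v = c • u := by
  rw [dslice_mulVec_comm hD] at hu hv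
  have hu' : u ∈ LinearMap.ker (contract3 D z).mulVecLin := by simpa using hu
  have hv' : v ∈ LinearMap.ker (contract3 D z).mulVecLin := by simpa using hv
  exact exists_smul_of_finrank_le_one (finrank_ker_dslice_le_one hD hz) hu' hv' hu0

/-! ## §2  Product covectors on words of length two -/

/-- The slice of `D^{⊠2}` at a product covector `λ ⊗ μ` is `D(λ) ⊗ D(μ)`. [folklore] -/
theorem slice_prod_apply (lam mu : Fin 3 → ℂ) (f g : Fin 2 → Fin 3) :
    contract3 (kroneckerPow D 2) (fun h : Fin 2 → Fin 3 => lam (h 0) * mu (h 1)) f g =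
      contract3 D lam (f 0) (g 0) * contract3 D mu (f 1) (g 1) := by
  rw [slice_apply, contract3_apply, contract3_apply, Finset.sum_mul_sum, sum_word_two]
  refine Finset.sum_congr rfl fun b _ => Finset.sum_congr rfl fun c _ => ?_
  simp only [Fin.prod_univ_two, Matrix.cons_val_zero, Matrix.cons_val_one]
  ring

/-- **Left annihilation**: if `D(λ) x̂ = 0` then `x̂` kills, from the left, the `3 × 3` reshaping of
every vector in `col T₂(λ ⊗ μ)`. [folklore] -/
theorem left_vanish (hD : ∀ a b c, D a b c = if a ≠ b ∧ b ≠ c ∧ a ≠ c then 1 else 0)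
    (lam mu xh : Fin 3 → ℂ) (hx : contract3 D lam *ᵥ xh = 0) (v : (Fin 2 → Fin 3) → ℂ) (c' : Fin 3) :
    ∑ b, xh b * (contract3 (kroneckerPow D 2) (fun h : Fin 2 → Fin 3 => lam (h 0) * mu (h 1)) *ᵥ v)
      ![b, c'] = 0 := by
  have hx' : xh ᵥ* contract3 D lam = 0 := by
    rw [← Matrix.mulVec_transpose, dslice_transpose hD]; exact hx
  have hrow : ∀ a, ∑ b, xh b * contract3 D lam b a = 0 := fun a => by
    have := congr_fun hx' a
    simpa [Matrix.vecMul, dotProduct] using this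
  simp only [Matrix.mulVec, dotProduct, slice_prod_apply, Matrix.cons_val_zero, Matrix.cons_val_one,
    Finset.mul_sum]
  rw [Finset.sum_comm]
  refine Finset.sum_eq_zero fun g _ => ?_
  calc ∑ b, xh b * (contract3 D lam b (g 0) * contract3 D mu c' (g 1) * v g)
      = (∑ b, xh b * contract3 D lam b (g 0)) * (contract3 D mu c' (g 1) * v g) := by
        rw [Finset.sum_mul]
        exact Finset.sum_congr rfl fun b _ => by ring
    _ = 0 := by rw [hrow (g 0), zero_mul]

/-- **Right annihilation**: if `D(μ) ŷ = 0` then `ŷ` kills, from the right, the `3 × 3` reshaping of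
every vector in `col T₂(λ ⊗ μ)`. [folklore] -/
theorem right_vanish (hD : ∀ a b c, D a b c = if a ≠ b ∧ b ≠ c ∧ a ≠ c then 1 else 0)
    (lam mu yh : Fin 3 → ℂ) (hy : contract3 D mu *ᵥ yh = 0) (v : (Fin 2 → Fin 3) → ℂ) (b' : Fin 3) :
    ∑ c, (contract3 (kroneckerPow D 2) (fun h : Fin 2 → Fin 3 => lam (h 0) * mu (h 1)) *ᵥ v)
      ![b', c] * yh c = 0 := by
  have hcol : ∀ a, ∑ c, contract3 D mu c a * yh c = 0 := fun a => by
    have := congr_fun hy a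
    rw [← dslice_transpose hD mu] at this
    simpa [Matrix.mulVec, dotProduct, Matrix.transpose_apply] using this
  simp only [Matrix.mulVec, dotProduct, slice_prod_apply, Matrix.cons_val_zero, Matrix.cons_val_one,
    Finset.sum_mul]
  rw [Finset.sum_comm]
  refine Finset.sum_eq_zero fun g _ => ?_
  calc ∑ c, contract3 D lam b' (g 0) * contract3 D mu c (g 1) * v g * yh c
      = (contract3 D lam b' (g 0) * v g) * ∑ c, contract3 D mu c (g 1) * yh c := by
        rw [Finset.mul_sum]
        exact Finset.sum_congr rfl fun c _ => by ring
    _ = 0 := by rw [hcol (g 1), mul_zero]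

/-! ## §3  The slice gap: splitting off the first letter -/

/-- **Splitting lemma (slice gap).**  A non-zero covector `θ` on words of length `N + 1` whose slice
has rank `< 3 · 2^N` is a product `θ = λ ⊗ ζ` of a first-letter covector `λ` with a vanishing
coordinate and a non-zero tail covector `ζ` with `2 · rank T_N(ζ) ≤ rank T_{N+1}(θ)`.
(Some component vanishes by `three_two_pow_le_rank_of_comps`, the others are pairwise dependent by
`three_two_pow_le_rank_of_pair`.) [cite: CoppersmithWinograd1990, §6] -/
theorem exists_prod_of_rank_lt (hD : ∀ a b c, D a b c = if a ≠ b ∧ b ≠ c ∧ a ≠ c then 1 else 0)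
    (N : ℕ) (θ : (Fin (N + 1) → Fin 3) → ℂ) (hθ : θ ≠ 0)
    (hr : (contract3 (kroneckerPow D (N + 1)) θ).rank < 3 * 2 ^ N) :
    ∃ (lam : Fin 3 → ℂ) (ζ : (Fin N → Fin 3) → ℂ) (a : Fin 3), lam a = 0 ∧ ζ ≠ 0 ∧
      (θ = fun f => lam (f 0) * ζ (Fin.tail f)) ∧
      2 * (contract3 (kroneckerPow D N) ζ).rank ≤ (contract3 (kroneckerPow D (N + 1)) θ).rank := by
  have third : ∀ p q : Fin 3, ∃ e : Fin 3, e ≠ p ∧ e ≠ q := by decide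
  -- some component vanishes
  have h1 : ∃ a : Fin 3, (fun v : Fin N → Fin 3 => θ (Fin.cons a v)) = 0 := by
    by_contra h
    push Not at h
    exact absurd (three_two_pow_le_rank_of_comps hD N θ h) (not_le.mpr hr)
  obtain ⟨a, ha⟩ := h1
  -- some component is non-zero
  have h2 : ∃ d : Fin 3, (fun v : Fin N → Fin 3 => θ (Fin.cons d v)) ≠ 0 := by
    by_contra h
    push Not at h
    exact hθ (eq_zero_of_comp_eq_zero h)
  obtain ⟨d, hd⟩ := h2
  -- every component is a multiple of the `d`-th
  have h3 : ∀ b : Fin 3, ∃ c : ℂ,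
      (fun v : Fin N → Fin 3 => θ (Fin.cons b v)) = c • (fun v : Fin N → Fin 3 => θ (Fin.cons d v)) := by
    intro b
    by_cases hbd : b = d
    · exact ⟨1, by rw [hbd, one_smul]⟩
    · refine exists_smul_of_not_pair hd fun hind => ?_
      obtain ⟨e, hed, heb⟩ := third d b
      exact absurd (three_two_pow_le_rank_of_pair hD N θ hed (Ne.symm hbd) heb hind) (not_le.mpr hr)
  choose c hc using h3
  refine ⟨c, fun v => θ (Fin.cons d v), a, ?_, hd, ?_, two_mul_rank_comp_le hD N θ d⟩
  · have h := hc a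
    rw [ha] at h
    exact (smul_eq_zero.mp h.symm).resolve_right hd
  · funext f
    have h := congr_fun (hc (f 0)) (Fin.tail f)
    simp only [Fin.cons_self_tail, Pi.smul_apply, smul_eq_mul] at h
    exact h

/-- **The slice gap of `D^{⊠2}`**: a non-zero covector `α` on words of length `2` with
`rank T₂(α) ≤ 5` is a product `λ ⊗ μ` with BOTH `D(λ)` and `D(μ)` singular (kernel vectors `x̂`, `ŷ`).
In particular the slice-rank spectrum of `D^{⊠2}` (equivalently of `cw₂^{⊠2}`) omits `5`.
[cite: CoppersmithWinograd1990, §6] -/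
theorem exists_prod_two (hD : ∀ a b c, D a b c = if a ≠ b ∧ b ≠ c ∧ a ≠ c then 1 else 0)
    (α : (Fin 2 → Fin 3) → ℂ) (hα : α ≠ 0) (hr : (contract3 (kroneckerPow D 2) α).rank ≤ 5) :
    ∃ lam mu xh yh : Fin 3 → ℂ, (α = fun f => lam (f 0) * mu (f 1)) ∧
      xh ≠ 0 ∧ contract3 D lam *ᵥ xh = 0 ∧ yh ≠ 0 ∧ contract3 D mu *ᵥ yh = 0 := by
  obtain ⟨lam, ζ, a, hlam, hζ, hprod, hrk⟩ :=
    exists_prod_of_rank_lt hD 1 α hα (lt_of_le_of_lt hr (by norm_num))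
  obtain ⟨xh, hx0, hx⟩ := exists_mulVec_eq_zero_of_coord hD a hlam
  have hrk2 : 2 * (contract3 (kroneckerPow D 1) ζ).rank ≤ (contract3 (kroneckerPow D 2) α).rank := hrk
  have hrk' : (contract3 D fun c => ζ fun _ => c).rank ≤ 2 := by
    rw [← rank_slice_one]; omega
  obtain ⟨yh, hy0, hy⟩ := exists_mulVec_eq_zero_of_rank_le_two hrk'
  refine ⟨lam, fun c => ζ fun _ => c, xh, yh, ?_, hx0, hx, hy0, hy⟩
  rw [hprod]
  funext f
  congr 2
  funext j
  fin_cases j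
  rfl

end Summit.MatrixMultiplication.MatrixMultiplication.Theorems.OutsiderSandwichSliceGap
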